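import Literature.NumberTheory.GaloisRepresentations.IdeleHomAssembly
import Literature.NumberTheory.GaloisRepresentations.IdeleTruncation
import HarnessLib

/-!
# Assembling a `G`-morphism into Harari's truncated idèles `J_{E,S}`: blocks off `S` set to `0`
# (Harari, *Galois Cohomology and CFT*, Prop. 17.26 (proof); Milne ADT I Lemma 4.13 (proof))

Topic `NumberTheory/GaloisRepresentations`; namespace `Literature.NumberTheory.GaloisRepresentations.IdeleReadout`; sequel
to door-c5's `IdeleHomAssembly.lean` (`ideleHomOfBlocks S φS φU φA : X ⟶ J_E` from local blocks) and to
`IdeleTruncation.lean` (`truncIdeles`, `truncRep`).  Definitions with bodies and theorems; NO named fact, no `sorry`, no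
instance, no notation; number fields in `Type`.

THE POINT.  The (R3)_S assembly step of the `S`-readout (successor file `IdeleProjectionSAssembly`, plan
`D3-SCOPING-w6g10.md` §5 (F2b)): local data at the places of `S` and at infinity ONLY assemble to a `Gal(E/F)`-morphism
`X ⟶ J_E` with trivial blocks off `S`, i.e. with values in `J_{E,S}`; packaged as a morphism `X ⟶ truncRep F E S`.

## What is formalised (`F E : Type` number fields, `S : Finset (HeightOneSpectrum (𝓞 F))`, `X : Rep ℤ Gal(E/F)`)

* **`ideleHomOfBlocks_zero_mem_truncIdeles`**: the values of `ideleHomOfBlocks S φS 0 φA` lie in `truncIdeles F E S`.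
* `truncHomOfBlocksAddHom` (+ `coe_toMul_truncHomOfBlocksAddHom_apply`), **`truncHomOfBlocks S φS φA : X ⟶ IdeleHerbrand.truncRep F E S`**
  (the corestriction), `truncHomOfBlocks_hom_apply`.

Written for lane «PT-Ш-S-TC» (brick D3 / D4b) of crux `GoodLatticeBDPValue` (cell bsd-eis, item 19032), seat
bsd-line-x1-p1-w6 gen 10.  HONEST FRAMING: bookkeeping; no arithmetic statement and no case of BSD is proved here.

## References
* D. Harari, *Galois Cohomology and Class Field Theory*, Universitext, Springer (2020), Prop. 17.26 (proof), Def. 17.22.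
  [Harari2020]
* J. S. Milne, *Arithmetic Duality Theorems*, 2nd ed. (2006), I Lemma 4.13 (proof). [MilneADT2006]
* J. W. S. Cassels, A. Fröhlich (eds.), *Algebraic Number Theory* (1967), Ch. VII (J. Tate) §7.3. [CasselsFrohlichANT1967]
-/

noncomputable section

open NumberField IsDedekindDomain CategoryTheory
open Literature.NumberTheory.Automorphic
open scoped Classical

namespace Literature.NumberTheory.GaloisRepresentations

namespace IdeleReadout

open IdeleCohomology

variable {F : Type} [Field F] [NumberField F] {E : Type} [Field E] [NumberField E] [Algebra F E]
variable (S : Finset (HeightOneSpectrum (𝓞 F))) {X : Rep.{0} ℤ (E ≃ₐ[F] E)}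
variable (φS : ∀ v : {v : HeightOneSpectrum (𝓞 F) // v ∈ S}, X ⟶ SemiLocal.unitsRep F E v.1)
  (φA : ∀ v : InfinitePlace F, X ⟶ ArchHerbrand.archUnitsRep (E := E) v)

/-- **With zero blocks off `S`, the assembled morphism takes values in `J_{E,S}`** (its semi-local block at `v ∉ S` is
`(∏ 𝒪_wˣ ↪ ∏ E_wˣ)(0) = 1`, so every component above `v` is `1`). [cite: Harari2020, Prop. 17.26 (proof)]
[cite: CasselsFrohlichANT1967, Ch. VII §7.3] -/
theorem ideleHomOfBlocks_zero_mem_truncIdeles (x : X.V) :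
    Additive.toMul (α := ideleGroup E) ((ideleHomOfBlocks S φS (fun _ => 0) φA).hom x) ∈
      IdeleHerbrand.truncIdeles F E S := fun w hw => by
  have h := placeProj_ideleHomOfBlocks_apply_of_not_mem S φS (fun _ => 0) φA hw x
  have h' : (placeProj (w.under (𝓞 F))).hom ((ideleHomOfBlocks S φS (fun _ => 0) φA).hom x) = 0 := by
    simpa [Rep.zero_hom] using h
  have h1 : IdeleHerbrand.blockHom F E (w.under (𝓞 F))
      (Additive.toMul (α := ideleGroup E) ((ideleHomOfBlocks S φS (fun _ => 0) φA).hom x)) = 1 :=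
    congrArg Additive.toMul h'
  have h2 := congrArg (fun u : (SemiLocal F E (w.under (𝓞 F)))ˣ => (u : SemiLocal F E (w.under (𝓞 F))) ⟨w, rfl⟩) h1
  rw [IdeleHerbrand.blockHom_apply] at h2
  exact h2

/-- The assembled map `X → J_{E,S}` on underlying additive groups. [cite: Harari2020, Prop. 17.26 (proof)] -/
def truncHomOfBlocksAddHom : X.V →+ Additive (IdeleHerbrand.truncIdeles F E S) :=
  AddMonoidHom.mk'
    (fun x => Additive.ofMul
      ⟨Additive.toMul (α := ideleGroup E) ((ideleHomOfBlocks S φS (fun _ => 0) φA).hom x),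
        ideleHomOfBlocks_zero_mem_truncIdeles S φS φA x⟩)
    fun x y => by
      apply Additive.toMul.injective
      apply Subtype.ext
      change Additive.toMul (α := ideleGroup E) ((ideleHomOfBlocks S φS (fun _ => 0) φA).hom (x + y)) =
        Additive.toMul (α := ideleGroup E) ((ideleHomOfBlocks S φS (fun _ => 0) φA).hom x) *
          Additive.toMul (α := ideleGroup E) ((ideleHomOfBlocks S φS (fun _ => 0) φA).hom y)
      rw [map_add]
      rfl

/-- Formula. [cite: Harari2020, Prop. 17.26 (proof)] -/
@[simp] theorem coe_toMul_truncHomOfBlocksAddHom_apply (x : X.V) :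
    ((Additive.toMul (truncHomOfBlocksAddHom S φS φA x) : IdeleHerbrand.truncIdeles F E S) : ideleGroup E) =
      Additive.toMul (α := ideleGroup E) ((ideleHomOfBlocks S φS (fun _ => 0) φA).hom x) := rfl

/-- **The assembled morphism `X ⟶ J_{E,S}`** from blocks at the places of `S` and at infinity (corestriction of
`ideleHomOfBlocks S φS 0 φA` to `truncRep F E S`). [cite: Harari2020, Prop. 17.26 (proof)] [cite: MilneADT2006, I Lemma 4.13 (proof)] -/
def truncHomOfBlocks : X ⟶ IdeleHerbrand.truncRep F E S :=
  letI : Module ℤ X.V := X.hV2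
  Rep.ofHom
    ⟨{ toFun := truncHomOfBlocksAddHom S φS φA
       map_add' := fun x y => map_add _ x y
       map_smul' := fun c x => by
         have h := map_intCast_smul (truncHomOfBlocksAddHom S φS φA) ℤ ℤ c x
         rw [RingHom.id_apply]
         exact h },
      fun g => LinearMap.ext fun x => by
        apply Additive.toMul.injective
        apply Subtype.ext
        change Additive.toMul (α := ideleGroup E) ((ideleHomOfBlocks S φS (fun _ => 0) φA).hom (X.ρ g x)) =
          g • Additive.toMul (α := ideleGroup E) ((ideleHomOfBlocks S φS (fun _ => 0) φA).hom x)
        rw [Rep.hom_comm_apply]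
        rfl⟩

/-- Formula: the underlying idèle of `truncHomOfBlocks x` is `ideleHomOfBlocks S φS 0 φA x`.
[cite: Harari2020, Prop. 17.26 (proof)] -/
theorem truncHomOfBlocks_hom_apply (x : X.V) :
    (truncHomOfBlocks S φS φA).hom x =
      (show X.V → (IdeleHerbrand.truncRep F E S).V from truncHomOfBlocksAddHom S φS φA) x := rfl

end IdeleReadout

end Literature.NumberTheory.GaloisRepresentations

end
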